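/-
Copyright (c) 2026 the pub-hodgecm-mathlib formalisation cell (harness21).  Prover seat hodgecm-mathlib-K2E5-p16 (g4): Track B «K2-LIT»,
hLiu418 = stmt-HodgeConjecture-24832, LEAD F0P6-plan (g11) LAST DEALS 2026-09-04T05:45:00Z (1) «Φ6b-1 `…XiConvergence`» (in force under LEAD
(g12)) = ROAD Φ organ Φ6b-1: ABSOLUTE CONVERGENCE of Shimura's `ξ(g, h; α, β)` on `Herm₂(ℂ)` for `re(α + β) > 3`; 2026-09-04.
-/
import Summits.HodgeConjecture.HodgeConjecture.Theorems.K2LiuHermTwoConfluentXiDefs         -- ★ (this seat): `xiTwoIntegrand`, `xiTwo`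
import Summits.HodgeConjecture.HodgeConjecture.Theorems.K2LiuHermTwoDetPowerIntegrable      -- ★ (this seat): the majorant is integrable, `σ > 3`
import HarnessLib

/-!
# Crux `HLiu418`, ROAD Φ, organ Φ6b-1: absolute convergence of Shimura's `ξ(g, h; α, β)` on `Herm₂(ℂ)` for `re(α + β) > 2κ − 1 = 3`

Cell `hodgecm-mathlib`, crux item hLiu418 = `stmt-HodgeConjecture-24832`, route of record `HCCMUnconditional`; squad K2, LEAD F0P6-plan (g11 → g12)
(LAST DEALS 05:45:00Z (1) «Φ6b-1»; REPORT-FIRST 06:1xZ with correction (A): the abscissa is `3`, not `2`), dealer K2E5-plan (g5) (CENSUS-41 row Φ6),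
prover K2E5-p16 (g4).  THEOREMS ONLY (no `def`, no instance, no notation, no named-fact hypothesis, no `sorry`, default heartbeats); lane
`--supports stmt-HodgeConjecture-24832 --as helper` (count-neutral helper).

WHAT IS PROVED [Shimura1982, (1.26), Case II, m = κ = 2].  For `g` positive definite, `h` Hermitian (`2 × 2` complex) and `(α, β) ∈ ℂ²`:
* `norm_cpow_neg_le` — `‖z^{−w}‖ ≤ e^{π|im w|} ‖z‖^{−re w}` (`z ≠ 0`, principal power; ★ `Complex.norm_cpow_of_ne_zero`, `|arg z| ≤ π`);
* `norm_xiTwoIntegrand_le` — THE DOMINATION `‖e(−τ(hx)) det(x+ig)^{−α} det(x−ig)^{−β}‖ ≤ e^{2π(|im α| + |im β|)} · |det(g + ix)|^{−re(α+β)}`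
  (`τ(hx)` is real for Hermitian `h`, ★ `trace_mul_hermTwo_of_isHermitian`; `|det(g − ix)| = |det(g + ix)| ≠ 0`, ★ `det_sub_I_smul_eq_conj`,
  ★ `norm_det_add_I_smul_pos`);
* `integrable_xiTwoIntegrand (hg : g.PosDef) (hh : h.IsHermitian) (hαβ : 3 < (α + β).re) : Integrable (xiTwoIntegrand g h α β)` —
  ABSOLUTE CONVERGENCE of `ξ(g, h; α, β)` in Shimura's range, by ★ `integrable_norm_det_add_I_smul_rpow_neg` (`σ = re(α+β) > 3`) and
  ★ `Integrable.mono'`;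
* `norm_xiTwo_le` — `‖ξ(g,h;α,β)‖ ≤ e^{2π(|im α|+|im β|)} · ∫ |det(g + ix)|^{−re(α+β)} dx` (uniform in `h`).
NOT here: holomorphy in `(α, β)`, the `η ∕ ω ∕ ζ` functions and the continuation beyond `re(α+β) > 3` (print-gated, acq-15212), estimates in `g, h`.
HONEST LABEL.  Count-neutral helper of the K2_Liu road; it pays no socket by itself: `HC_CM` is proved only modulo the 7 printed citations
(2 remaining named inputs: hLiu418 = `stmt-HodgeConjecture-24832`, h413 = `stmt-HodgeConjecture-24833`) until rung 0 closes.
-/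

set_option autoImplicit false
-- the mandated namespace repeats the single-problem summit's segment (`HodgeConjecture.HodgeConjecture`)
set_option linter.dupNamespace false

noncomputable section

open Complex MeasureTheory Set
open scoped ComplexOrder ComplexConjugate

namespace Summit.HodgeConjecture.HodgeConjecture.Cruxes.HLiu418.K2LiuHermTwoConfluentXiConvergence

open Summit.HodgeConjecture.HodgeConjecture.Cruxes.HLiu418.K2LiuHermTwoGammaDefs
open Summit.HodgeConjecture.HodgeConjecture.Cruxes.HLiu418.K2LiuHermTwoDetPowerFibres
open Summit.HodgeConjecture.HodgeConjecture.Cruxes.HLiu418.K2LiuHermTwoDetPowerIntegrable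
open Summit.HodgeConjecture.HodgeConjecture.Cruxes.HLiu418.K2LiuHermTwoConfluentXiDefs

/-! ## Norms of principal powers -/

/-- `‖z^{−w}‖ ≤ e^{π |im w|} · ‖z‖^{−re w}` for `z ≠ 0` (principal power: `‖z^{−w}‖ = ‖z‖^{−re w} e^{arg z · im w}` and `|arg z| ≤ π`). -/
theorem norm_cpow_neg_le {z : ℂ} (hz : z ≠ 0) (w : ℂ) :
    ‖z ^ (-w)‖ ≤ Real.exp (Real.pi * |w.im|) * ‖z‖ ^ (-w.re) := by
  rw [Complex.norm_cpow_of_ne_zero hz, neg_re, neg_im, mul_neg, Real.exp_neg, div_inv_eq_mul, mul_comm]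
  refine mul_le_mul_of_nonneg_right ?_ (Real.rpow_nonneg (norm_nonneg _) _)
  refine Real.exp_le_exp.mpr ?_
  calc arg z * w.im ≤ |arg z * w.im| := le_abs_self _
    _ = |arg z| * |w.im| := abs_mul _ _
    _ ≤ Real.pi * |w.im| := mul_le_mul_of_nonneg_right (Complex.abs_arg_le_pi z) (abs_nonneg _)

/-- `‖e^{−2πi t}‖ = 1` for real `t`. -/
theorem norm_cexp_neg_two_pi_I_mul_ofReal (t : ℝ) : ‖cexp (-(2 * Real.pi * I) * (t : ℂ))‖ = 1 := by
  rw [Complex.norm_exp]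
  simp

/-! ## The domination of the `ξ`-integrand -/

/-- THE DOMINATION: for `g > 0` and `h` Hermitian,
`‖ξ-integrand(g, h; α, β)(x)‖ ≤ e^{2π(|im α| + |im β|)} · |det(g + ix)|^{−re(α+β)}`. -/
theorem norm_xiTwoIntegrand_le {g h : Matrix (Fin 2) (Fin 2) ℂ} (hg : g.PosDef) (hh : h.IsHermitian) (α β : ℂ) (c : ℝ × ℂ × ℝ) :
    ‖xiTwoIntegrand g h α β c‖ ≤
      Real.exp (2 * Real.pi * (|α.im| + |β.im|)) * ‖(g + I • hermTwo c).det‖ ^ (-(α + β).re) := by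
  have hDpos : 0 < ‖(g + I • hermTwo c).det‖ := norm_det_add_I_smul_pos hg c
  have hD : (g + I • hermTwo c).det ≠ 0 := norm_pos_iff.mp hDpos
  have hDm : (g - I • hermTwo c).det = conj ((g + I • hermTwo c).det) := det_sub_I_smul_eq_conj hg c
  have hDm0 : (g - I • hermTwo c).det ≠ 0 := by
    rw [hDm]
    exact (map_ne_zero _).mpr hD
  have hnormm : ‖(g - I • hermTwo c).det‖ = ‖(g + I • hermTwo c).det‖ := by
    rw [hDm, Complex.norm_conj]
  -- the pieces
  have h0 : ‖cexp ((Real.pi * I) * (β - α))‖ ≤ Real.exp (Real.pi * (|α.im| + |β.im|)) := by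
    rw [Complex.norm_exp]
    refine Real.exp_le_exp.mpr ?_
    simp only [mul_re, mul_im, ofReal_re, ofReal_im, I_re, I_im, sub_re, sub_im, mul_zero, mul_one, zero_mul, sub_zero,
      add_zero]
    nlinarith [le_abs_self α.im, neg_abs_le α.im, le_abs_self β.im, neg_abs_le β.im, Real.pi_pos]
  have h1 : ‖cexp (-(2 * Real.pi * I) * (h * hermTwo c).trace)‖ = 1 := by
    rw [trace_mul_hermTwo_of_isHermitian hh c]
    exact norm_cexp_neg_two_pi_I_mul_ofReal _
  have h2 : ‖(g - I • hermTwo c).det ^ (-α)‖ ≤ Real.exp (Real.pi * |α.im|) * ‖(g + I • hermTwo c).det‖ ^ (-α.re) := by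
    rw [← hnormm]
    exact norm_cpow_neg_le hDm0 α
  have h3 : ‖(g + I • hermTwo c).det ^ (-β)‖ ≤ Real.exp (Real.pi * |β.im|) * ‖(g + I • hermTwo c).det‖ ^ (-β.re) :=
    norm_cpow_neg_le hD β
  have hpow : ‖(g + I • hermTwo c).det‖ ^ (-α.re) * ‖(g + I • hermTwo c).det‖ ^ (-β.re) =
      ‖(g + I • hermTwo c).det‖ ^ (-(α + β).re) := by
    rw [← Real.rpow_add hDpos, add_re]
    congr 1
    ring
  have hexp : Real.exp (Real.pi * (|α.im| + |β.im|)) * (Real.exp (Real.pi * |α.im|) * Real.exp (Real.pi * |β.im|)) =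
      Real.exp (2 * Real.pi * (|α.im| + |β.im|)) := by
    rw [← Real.exp_add, ← Real.exp_add]
    congr 1
    ring
  rw [xiTwoIntegrand_eq, norm_mul, norm_mul, norm_mul, h1, one_mul]
  calc ‖cexp ((Real.pi * I) * (β - α))‖ * (‖(g - I • hermTwo c).det ^ (-α)‖ * ‖(g + I • hermTwo c).det ^ (-β)‖)
      ≤ Real.exp (Real.pi * (|α.im| + |β.im|)) *
          ((Real.exp (Real.pi * |α.im|) * ‖(g + I • hermTwo c).det‖ ^ (-α.re)) *
            (Real.exp (Real.pi * |β.im|) * ‖(g + I • hermTwo c).det‖ ^ (-β.re))) := by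
        gcongr
    _ = Real.exp (2 * Real.pi * (|α.im| + |β.im|)) * ‖(g + I • hermTwo c).det‖ ^ (-(α + β).re) := by
        rw [← hexp, ← hpow]
        ring

/-! ## Absolute convergence of `ξ` -/

/-- **ABSOLUTE CONVERGENCE OF SHIMURA'S `ξ` ON `Herm₂(ℂ)`** (organ Φ6b-1; [Shimura1982, (1.26), Case II, m = κ = 2]): for `g` positive definite,
`h` Hermitian and `re(α + β) > 3 = 2κ − 1`, the integrand `e(−τ(hx)) det(x + ig)^{−α} det(x − ig)^{−β}` of `ξ(g, h; α, β)` is INTEGRABLE on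
`Herm₂(ℂ)` (Lebesgue measure of the chart `ℝ × ℂ × ℝ`), so `xiTwo g h α β` is a genuine absolutely convergent integral there. -/
theorem integrable_xiTwoIntegrand {g h : Matrix (Fin 2) (Fin 2) ℂ} (hg : g.PosDef) (hh : h.IsHermitian) {α β : ℂ}
    (hαβ : 3 < (α + β).re) : Integrable (xiTwoIntegrand g h α β) := by
  refine Integrable.mono' ((integrable_norm_det_add_I_smul_rpow_neg hg hαβ).const_mul (Real.exp (2 * Real.pi * (|α.im| + |β.im|))))
    (aestronglyMeasurable_xiTwoIntegrand g h α β) (Filter.Eventually.of_forall fun c => ?_)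
  exact norm_xiTwoIntegrand_le hg hh α β c

/-- The uniform bound `‖ξ(g, h; α, β)‖ ≤ e^{2π(|im α| + |im β|)} · ∫ |det(g + ix)|^{−re(α+β)} dx` (independent of `h`), for `re(α+β) > 3`. -/
theorem norm_xiTwo_le {g h : Matrix (Fin 2) (Fin 2) ℂ} (hg : g.PosDef) (hh : h.IsHermitian) {α β : ℂ} (hαβ : 3 < (α + β).re) :
    ‖xiTwo g h α β‖ ≤
      Real.exp (2 * Real.pi * (|α.im| + |β.im|)) * ∫ c : ℝ × ℂ × ℝ, ‖(g + I • hermTwo c).det‖ ^ (-(α + β).re) := by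
  rw [xiTwo_def, ← integral_const_mul]
  refine norm_integral_le_of_norm_le
    ((integrable_norm_det_add_I_smul_rpow_neg hg hαβ).const_mul (Real.exp (2 * Real.pi * (|α.im| + |β.im|)))) ?_
  exact Filter.Eventually.of_forall fun c => norm_xiTwoIntegrand_le hg hh α β c

end Summit.HodgeConjecture.HodgeConjecture.Cruxes.HLiu418.K2LiuHermTwoConfluentXiConvergence

end
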